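import Literature.InformationTheory.QuantumCodes.CorrectableRegions
import Literature.InformationTheory.QuantumCodes.CSSStabilizer
import Literature.InformationTheory.QuantumCodes.CSSQuantumErasureChannel
import Literature.InformationTheory.QuantumCodes.StabilizerDistance
import Literature.InformationTheory.QuantumCodes.DistanceFailureFloor
import HarnessLib

/-!
# The quantum erasure channel for STABILIZER codes: `ε_c ≤ 1/2` (no cloning) and `Q = 1 − 2ε`
# (Bennett–DiVincenzo–Smolin) in the binary symplectic vocabulary

Topic `Literature/InformationTheory/QuantumCodes` (venture QEC, LADDER-QEC rung Q5; qec-lit-2 gen 6). Theorem-only: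
no definition, no named fact, no `sorry`, kernel axioms.

**Printed statements.** Bennett–DiVincenzo–Smolin 1997, p. 3218: the quantum erasure channel (QEC) erases each qubit,
at a position known to the receiver, with probability `ε`; its one-way quantum capacity is `Q = max{0, 1 − 2ε}` —
"To show that the QEC's one-way capacity `Q` must vanish for `ε ≥ ½` suppose the contrary. The sender … could then
clone …"; "Linear interpolation between the 50% QEC and the noiseless channel yields an upper bound `Q ≤ 1 − 2ε`,
which coincides with the lower bound obtained by using one-way random hash coding" (footnote cf2: "identical to
random linear stabilizer codes"); "two bits of redundancy per erased qubit are necessary and sufficient". Delfosse–Zémor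
2013 §3: for stabilizer codes on the erasure channel `R ≤ 1 − 2p` by a combinatorial count. Bravyi–Poulin–Terhal 2010
Eqs. (5)–(8): `Λ = A ⊔ B ⊔ C` with `A`, `B` correctable ⇒ `k ≤ |C|` — in the tree for every stabilizer code as
`le_card_compl_of_isCorrectable` (`CorrectableRegions.lean`).

**Model** (the tree's, nothing new). A stabilizer (= binary additive) code is a self-orthogonal `S̄ ≤ 𝔽₂ⁿ × 𝔽₂ⁿ` with
`dim S̄ + k = n` (`IsAdditiveCode S̄ k d` of `SymplecticCodes.lean`; any `d`, the distance plays no role here). The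
erased set `M ⊆ Fin n` is recoverable iff it is a correctable region, `IsCorrectableRegion S̄ M` (`CorrectableRegions.lean`:
no non-trivial logical operator lives inside `M` — the Knill–Laflamme condition for the erasure of `M`), and the
failure probability of the code at erasure rate `y` is `eventProb (fun M => ¬ IsCorrectableRegion S̄ M) y`
(`CodeCapacityNoise.lean`: `Σ_M y^{|M|}(1−y)^{n−|M|}·𝟙[M not correctable]`), written inline throughout.

**Results** (all PROVED here).
* `CSSCode.isCorrectableRegion_toSympCode_iff` — dictionary: for a check-matrix CSS code, `M` is a correctable region of
  its stabilizer space `rs H^X × rs H^Z` iff `M` is correctable for the `Z`-sector AND for the `X`-sector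
  (`IsCorrectableErasure` of `ErasureDecoding.lean`); so this file's failure event restricted to CSS codes is exactly the
  joint event of `CSSQuantumErasureChannel.lean`.
* NO CLONING (`k ≥ 1`): `not_isCorrectableRegion_compl` (`M` and `Mᶜ` are never both correctable — `k ≤ |∅|`),
  `one_le_erasureFailure_add_erasureFailure_one_sub` (`1 ≤ P_y + P_{1−y}`), `half_le_erasureFailure_of_half_le`
  (`½ ≤ P_y` for every `½ ≤ y ≤ 1`); families: no rate `y ≥ ½` is below threshold, every certified erasure threshold
  is `≤ ½`, `accuracyThreshold ≤ ½` (`stabilizer_erasure_accuracyThreshold_le_half`) — "Q must vanish for ε ≥ ½".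
* FINITE-SIZE RATE BOUND: `stabilizer_k_le_card_mul_erasure` — for rates `a, b ≥ 0`, `a + b ≤ 1`,
  `k ≤ n·(1 − a − b + P_a + P_b)` (disjoint coupling of two erasure patterns, marginals `Ber(a)`, `Ber(b)`, and the
  holographic bound pointwise); `stabilizer_k_le_card_mul_quantumErasure`: `k ≤ n·(1 − 2ε + 2·P_ε)` for `0 ≤ ε ≤ ½` —
  the code-level form of "two bits of redundancy per erased qubit are necessary".
* CONVERSE for families with `k_i ≥ 1` and rate `≥ R` (`R·n_i ≤ k_i`): `stabilizer_erasure_rates_add_le_one_sub_rate`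
  (two below-threshold rates cost `a + b ≤ 1 − R`), `stabilizer_quantumErasure_rate_le` (below threshold at `ε` ⇒
  `2ε ≤ 1 − R`), `stabilizer_quantumErasure_threshold_le_half_sub_rate` and
  `stabilizer_quantumErasure_accuracyThreshold_le_half_sub_rate` (`ε_c ≤ (1 − R)/2`).
* ACHIEVABILITY transported from `CSSQuantumErasureChannel.lean`: `exists_stabilizerFamily_quantumErasure_tendsto_zero` —
  for `0 < ε`, `0 ≤ R`, `2ε < 1 − R` there are stabilizer codes `S̄_n ≤ 𝔽₂ⁿ × 𝔽₂ⁿ` (the CSS ones) with `k_n ≥ R n`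
  whose erasure-failure probability tends to `0` at every rate `0 ≤ ε' ≤ ε`.

* THE DISTANCE FLOOR (appended; qec-lit-2 gen 7): an erasure containing the support of a logical operator is
  uncorrectable (`not_isCorrectableRegion_of_sympSupport_subset` — DZ13 §3.1: "when the erasure vector covers a
  problematic error … we have a non-correctable erasure"), so `y^{wt L} ≤ P_y[uncorrectable]` for every
  `L ∈ S̄⊥ ∖ S̄` (`pow_sympWeight_le_erasureFailure`), `y^d ≤ P_y` with `d = minDistance S̄`
  (`pow_minDistance_le_erasureFailure`, `pow_le_erasureFailure_of_minDistance_le`; `…_of_code` for an `[[n,k,d]]`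
  code with `k ≥ 1`); families of subspaces with a logical operator: bounded `minDistance` ⇒ no erasure rate
  `0 < y ≤ 1` is below threshold and the erasure accuracy
  threshold is `0` (`stabilizer_erasure_not_belowThreshold_of_minDistance_le`,
  `stabilizer_erasure_accuracyThreshold_eq_zero_of_minDistance_le`); ONE below-threshold erasure rate ⇒
  `minDistance S̄_i → ∞` (`tendsto_minDistance_atTop_of_erasure_belowThreshold`). No self-orthogonality is used.

Not claimed: non-additive codes `((n,K))`; the strong converse at `R = 1 − 2ε` exactly; BDS97's information-theoretic
proof (no-cloning + interpolation) — the proofs here are the combinatorial ones (holographic bound, reflection `M ↦ Mᶜ`).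

## References

* [BennettDivincenzoSmolin1997] C. H. Bennett, D. P. DiVincenzo, J. A. Smolin, PRL 78 (1997) 3217 =
  arXiv:quant-ph/9701015, p. 3218 (chunk p0003 L57–83: `Q = max{0, 1−2ε}`; no-cloning for `ε ≥ ½`; `Q ≤ 1−2ε`;
  "necessary and sufficient"; p0006 L43 footnote cf2 "identical to random linear stabilizer codes").
* [DelfosseZemor2013] N. Delfosse, G. Zémor, QIC 13 (2013) 793 = arXiv:1205.7036, §3 eq. (capacity), §3.3, Thm. 3.5
  (`R ≤ 1 − 2p` for stabilizer codes); §3.1 (chunk p0007 L40–L47: erasure law `p^{|ℰ|}(1−p)^{n−|ℰ|}`, "E ⊂ ℰ";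
  L62–L66: "when the erasure vector covers a problematic error, we will say that we have a non-correctable erasure").
* [BravyiPoulinTerhal2010] S. Bravyi, D. Poulin, B. Terhal, PRL 104 (2010) 050503, Eqs. (5)–(8) (`k ≤ |C|`).
* [BravyiTerhal2009] S. Bravyi, B. Terhal, NJP 11 (2009) 043029, §2 Lemma 1 (Cleaning Lemma).
* [DennisEtAl2002] E. Dennis, A. Kitaev, A. Landahl, J. Preskill, J. Math. Phys. 43 (2002) 4452, §4.3, §4.6
  (below threshold, `p_c`).
-/

namespace Literature.InformationTheory.QuantumCodes

open Finset Matrix Filter Topology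

/-! ### Dictionary: correctable regions of a CSS stabilizer space are the jointly correctable erasures -/

namespace CSSCode

variable {n : ℕ} {RX RZ : Type*} [Fintype RX] [Fintype RZ]

/-- Membership in the support of a binary vector. [folklore] -/
private theorem mem_supp_iff'' {x : Fin n → ZMod 2} {v : Fin n} : v ∈ supp x ↔ x v ≠ 0 := by
  simp [supp]

/-- **Correctable regions of a CSS code = erasures correctable in both sectors.** For a check-matrix CSS code on
`Fin n`, a set of qubits `M` is a correctable region of the stabilizer space `rs H^X × rs H^Z` (no logical `(a|b)` with
`H^Z a = 0`, `H^X b = 0` supported in `M` outside the stabilizer) iff `M` is a correctable erasure for the `Z`-sector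
(every `z ∈ ker H^X` supported in `M` is a `Z`-stabilizer) and for the `X`-sector.
[cite: BravyiTerhal2009, §2 Lemma 1 (case (1): a logical operator supported in M); CalderbankEtAl1998, §5 Thm. 9 (CSS codes as additive codes)] -/
theorem isCorrectableRegion_toSympCode_iff (C : CSSCode RX RZ (Fin n)) (M : Finset (Fin n)) :
    IsCorrectableRegion C.toSympCode M ↔
      IsCorrectableErasure {x : Fin n → ZMod 2 | C.HX *ᵥ x = 0} (C.rowSpZ : Set (Fin n → ZMod 2)) M ∧
        IsCorrectableErasure {x : Fin n → ZMod 2 | C.HZ *ᵥ x = 0} (C.rowSpX : Set (Fin n → ZMod 2)) M := by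
  constructor
  · intro h
    constructor
    · intro x hx hxM
      rw [Set.mem_setOf_eq] at hx
      have hv : ((0, x) : SympVec n) ∈ sympDual C.toSympCode :=
        (C.mem_sympDual_toSympCode_iff _).2 ⟨by simp, hx⟩
      have hvM : ((0, x) : SympVec n) ∈ supportedOn M := by
        intro i hi
        refine ⟨rfl, ?_⟩
        by_contra hne
        exact hi (hxM (mem_supp_iff''.2 hne))
      exact ((C.mem_toSympCode_iff _).1 (h _ hv hvM)).2
    · intro x hx hxM
      rw [Set.mem_setOf_eq] at hx
      have hv : ((x, 0) : SympVec n) ∈ sympDual C.toSympCode :=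
        (C.mem_sympDual_toSympCode_iff _).2 ⟨hx, by simp⟩
      have hvM : ((x, 0) : SympVec n) ∈ supportedOn M := by
        intro i hi
        refine ⟨?_, rfl⟩
        by_contra hne
        exact hi (hxM (mem_supp_iff''.2 hne))
      exact ((C.mem_toSympCode_iff _).1 (h _ hv hvM)).1
  · rintro ⟨hZ, hX⟩ v hv hvM
    obtain ⟨h1, h2⟩ := (C.mem_sympDual_toSympCode_iff v).1 hv
    refine (C.mem_toSympCode_iff v).2 ⟨hX v.1 h1 ?_, hZ v.2 h2 ?_⟩
    · intro i hi
      by_contra hiM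
      exact (mem_supp_iff''.1 hi) (hvM i hiM).1
    · intro i hi
      by_contra hiM
      exact (mem_supp_iff''.1 hi) (hvM i hiM).2

end CSSCode

/-! ### No cloning: a region and its complement are never both correctable (`k ≥ 1`) -/

section NoCloning

variable {n : ℕ} {S : Submodule (ZMod 2) (SympVec n)} {k d : ℕ}

/-- **No cloning for stabilizer codes.** If `k ≥ 1`, a correctable region has a NON-correctable complement
(holographic bound with `C = ∅`: `k ≤ |Λ ∖ (M ∪ Mᶜ)| = 0`). This is the combinatorial shadow of "Alice could then
clone quantum information faithfully by dividing it between two receivers".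
[cite: BennettDivincenzoSmolin1997, p. 3218 (Q must vanish for ε ≥ ½: cloning); BravyiPoulinTerhal2010, Eqs. (5)–(8)] -/
theorem not_isCorrectableRegion_compl (hcode : IsAdditiveCode S k d) (hk : 1 ≤ k) {M : Finset (Fin n)}
    (hM : IsCorrectableRegion S M) : ¬ IsCorrectableRegion S Mᶜ := by
  intro hMc
  have h := le_card_compl_of_isCorrectable hcode hM hMc
  rw [union_compl, Finset.compl_univ, card_empty] at h
  omega

/-- For `k ≥ 1`, every erasure pattern is uncorrectable itself or has an uncorrectable complement.
[cite: BennettDivincenzoSmolin1997, p. 3218 (cloning argument)] -/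
theorem not_isCorrectableRegion_or_compl (hcode : IsAdditiveCode S k d) (hk : 1 ≤ k) (M : Finset (Fin n)) :
    ¬ IsCorrectableRegion S M ∨ ¬ IsCorrectableRegion S Mᶜ := by
  by_cases hM : IsCorrectableRegion S M
  · exact Or.inr (not_isCorrectableRegion_compl hcode hk hM)
  · exact Or.inl hM

/-- Uncorrectability is up-closed: enlarging an uncorrectable erasure keeps it uncorrectable.
[cite: BravyiPoulinTerhal2010, Definitions and notations (p. 2: a subregion of a correctable region is correctable)] -/
theorem not_isCorrectableRegion_mono {A B : Finset (Fin n)} (hAB : A ⊆ B) (hA : ¬ IsCorrectableRegion S A) :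
    ¬ IsCorrectableRegion S B :=
  fun hB => hA (hB.mono hAB)

open Classical in
/-- **Complementary erasure rates**: for a stabilizer code with `k ≥ 1` and `0 ≤ y ≤ 1`,
`1 ≤ P_y[erasure uncorrectable] + P_{1−y}[erasure uncorrectable]` (reflect the second pattern, `M ↦ Mᶜ`, and use
no cloning pointwise). [cite: BennettDivincenzoSmolin1997, p. 3218 (an ε ≥ ½ QEC to each receiver)] -/
theorem one_le_erasureFailure_add_erasureFailure_one_sub (hcode : IsAdditiveCode S k d) (hk : 1 ≤ k) {y : ℝ}
    (hy0 : 0 ≤ y) (hy1 : y ≤ 1) :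
    1 ≤ eventProb (fun M : Finset (Fin n) => ¬ IsCorrectableRegion S M) y +
      eventProb (fun M : Finset (Fin n) => ¬ IsCorrectableRegion S M) (1 - y) := by
  have h1 : eventProb (fun _ : Finset (Fin n) => True) y ≤
      eventProb (fun M : Finset (Fin n) => ¬ IsCorrectableRegion S M ∨ ¬ IsCorrectableRegion S Mᶜ) y :=
    eventProb_mono (fun M _ => not_isCorrectableRegion_or_compl hcode hk M) hy0 hy1
  rw [eventProb_true] at h1
  have h2 := eventProb_or_le (fun M : Finset (Fin n) => ¬ IsCorrectableRegion S M)
    (fun M : Finset (Fin n) => ¬ IsCorrectableRegion S Mᶜ) hy0 hy1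
  have h3 := eventProb_one_sub (fun M : Finset (Fin n) => ¬ IsCorrectableRegion S M) y
  linarith

open Classical in
/-- **Half of all erasure patterns at rate `½` are uncorrectable** (`k ≥ 1`): `½ ≤ P_{1/2}[uncorrectable]`.
[cite: BennettDivincenzoSmolin1997, p. 3218 (the 50% QEC has Q = 0)] -/
theorem half_le_erasureFailure_half (hcode : IsAdditiveCode S k d) (hk : 1 ≤ k) :
    1 / 2 ≤ eventProb (fun M : Finset (Fin n) => ¬ IsCorrectableRegion S M) (1 / 2) := by
  have h := one_le_erasureFailure_add_erasureFailure_one_sub hcode hk (y := 1 / 2) (by norm_num) (by norm_num)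
  norm_num at h
  linarith

open Classical in
/-- **No stabilizer code with `k ≥ 1` tolerates erasure rates `≥ ½`**: `½ ≤ P_y[uncorrectable]` for every
`½ ≤ y ≤ 1` (monotonicity of the up-closed failure event in the rate).
[cite: BennettDivincenzoSmolin1997, p. 3218 (Q must vanish for ε ≥ ½)] -/
theorem half_le_erasureFailure_of_half_le (hcode : IsAdditiveCode S k d) (hk : 1 ≤ k) {y : ℝ} (hy : 1 / 2 ≤ y)
    (hy1 : y ≤ 1) : 1 / 2 ≤ eventProb (fun M : Finset (Fin n) => ¬ IsCorrectableRegion S M) y :=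
  (half_le_erasureFailure_half hcode hk).trans
    (eventProb_mono_rate _ (fun _ _ hAB hA => not_isCorrectableRegion_mono hAB hA) (by norm_num) hy hy1)

end NoCloning

/-! ### The finite-size rate bound `k ≤ n (1 − a − b + P_a + P_b)` -/

section Finite

variable {n : ℕ} {S : Submodule (ZMod 2) (SympVec n)} {k d : ℕ}

/-- `k ≤ n` for an additive code (`dim S̄ + k = n`). [cite: CalderbankEtAl1998, §2 Thm. 1 (an [[n,k,d]] code from S̄ of dimension n − k)] -/
theorem IsAdditiveCode.k_le (hcode : IsAdditiveCode S k d) : k ≤ n := by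
  have h := hcode.2.1
  omega

/-- An erasure event's probability as a weighted indicator sum (any decidability instances).
[cite: DennisEtAl2002, §4.3 eq. (ec_cond)] -/
theorem sum_bernoulliWeight_mul_ite_eq_eventProb_not {V : Type*} [Fintype V] (P : Finset V → Prop) (p : ℝ)
    [DecidablePred P] [DecidablePred fun E : Finset V => ¬ P E] :
    ∑ E : Finset V, bernoulliWeight p E * (if P E then 0 else 1) = eventProb (fun E : Finset V => ¬ P E) p := by
  rw [eventProb_eq_sum_ite]
  refine Finset.sum_congr rfl fun E _ => ?_
  by_cases h : P E
  · rw [if_pos h, if_neg (not_not.2 h), mul_zero]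
  · rw [if_neg h, if_pos h, mul_one]

open Classical in
/-- Pointwise bound under the disjoint coupling: for disjoint `A`, `B` and a weight `w ≥ 0`,
`w(|A| + |B|) ≤ w(n − k) + n·w·𝟙[A not correctable] + n·w·𝟙[B not correctable]` (both correctable: the holographic
bound `k ≤ |Λ ∖ (A ∪ B)|`; otherwise `|A| + |B| ≤ n`). [cite: BravyiPoulinTerhal2010, Eqs. (5)–(8)] -/
private theorem pointwise_stabilizer_rate_bound (hcode : IsAdditiveCode S k d) (A B : Finset (Fin n)) (hB : B ⊆ Aᶜ)
    {w : ℝ} (hw : 0 ≤ w) :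
    w * (A.card : ℝ) + w * (B.card : ℝ) ≤
      w * ((n : ℝ) - k) +
        (n : ℝ) * (w * (if IsCorrectableRegion S A then 0 else 1)) +
        (n : ℝ) * (w * (if IsCorrectableRegion S B then 0 else 1)) := by
  have hkn : (k : ℝ) ≤ n := by exact_mod_cast hcode.k_le
  have hABn : A.card + B.card ≤ n := by
    have h1 := Finset.card_le_card hB
    rw [Finset.card_compl, Fintype.card_fin] at h1
    have h2 := A.card_le_univ
    rw [Fintype.card_fin] at h2
    omega
  have hAB : (A.card : ℝ) + B.card ≤ n := by exact_mod_cast hABn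
  have hk1 := mul_le_mul_of_nonneg_left hAB hw
  have hk2 := mul_le_mul_of_nonneg_left hkn hw
  have hn : (0 : ℝ) ≤ n := Nat.cast_nonneg _
  by_cases hA : IsCorrectableRegion S A
  · by_cases hB' : IsCorrectableRegion S B
    · rw [if_pos hA, if_pos hB']
      have h := le_card_compl_of_isCorrectable hcode hA hB'
      have hdisj : A ∩ B = ∅ := by
        ext i
        simp only [Finset.mem_inter, Finset.notMem_empty, iff_false, not_and]
        intro hiA hiB
        exact (Finset.mem_compl.1 (hB hiB)) hiA
      have hu := Finset.card_union_add_card_inter A B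
      rw [hdisj, card_empty, add_zero] at hu
      rw [Finset.card_compl, Fintype.card_fin, hu] at h
      have h3 : (k : ℝ) + A.card + B.card ≤ n := by
        exact_mod_cast (by omega : k + A.card + B.card ≤ n)
      have h4 := mul_le_mul_of_nonneg_left h3 hw
      nlinarith [h4]
    · rw [if_pos hA, if_neg hB']
      nlinarith [hk1, hk2]
  · rw [if_neg hA]
    have hi : (0 : ℝ) ≤ w * (if IsCorrectableRegion S B then 0 else 1) :=
      mul_nonneg hw (by split_ifs <;> norm_num)
    nlinarith [hk1, hk2, mul_nonneg hn hi]

open Classical in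
/-- **FINITE-SIZE RATE BOUND for stabilizer codes.** For every stabilizer code `S̄ ≤ 𝔽₂ⁿ × 𝔽₂ⁿ` with `k` logical
qubits and erasure rates `a, b ≥ 0` with `a + b ≤ 1`:
`k ≤ n · (1 − a − b + P_a[erasure uncorrectable] + P_b[erasure uncorrectable])` (couple an `a`-erasure and a
`b`-erasure disjointly and average the holographic bound). [cite: BennettDivincenzoSmolin1997, p. 3218 (Q ≤ 1 − 2ε); DelfosseZemor2013, §3.3–3.4 (R ≤ 1 − 2p, Thm. 3.5); BravyiPoulinTerhal2010, Eqs. (5)–(8)] -/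
theorem stabilizer_k_le_card_mul_erasure (hcode : IsAdditiveCode S k d) {a b : ℝ} (ha : 0 ≤ a) (hb : 0 ≤ b)
    (hab : a + b ≤ 1) :
    (k : ℝ) ≤ n * (1 - a - b +
      eventProb (fun M : Finset (Fin n) => ¬ IsCorrectableRegion S M) a +
      eventProb (fun M : Finset (Fin n) => ¬ IsCorrectableRegion S M) b) := by
  have hw : ∀ A B : Finset (Fin n), 0 ≤ a ^ A.card * (b ^ B.card * (1 - a - b) ^ (Aᶜ.card - B.card)) :=
    fun A B => mul_nonneg (pow_nonneg ha _) (mul_nonneg (pow_nonneg hb _) (pow_nonneg (by linarith) _))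
  have hsum := Finset.sum_le_sum fun A (_ : A ∈ (univ : Finset (Finset (Fin n)))) =>
    Finset.sum_le_sum fun B (hB : B ∈ (Aᶜ).powerset) =>
      pointwise_stabilizer_rate_bound hcode A B (Finset.mem_powerset.1 hB) (hw A B)
  simp only [Finset.sum_add_distrib, ← Finset.mul_sum] at hsum
  rw [sum_pairWeight_mul_left a b (fun A => (A.card : ℝ)),
    sum_pairWeight_mul_right a b (fun B => (B.card : ℝ)),
    sum_pairWeight_mul_left a b (fun _ => (n : ℝ) - k),
    sum_pairWeight_mul_left a b (fun A => if IsCorrectableRegion S A then (0 : ℝ) else 1),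
    sum_pairWeight_mul_right a b (fun B => if IsCorrectableRegion S B then (0 : ℝ) else 1),
    sum_bernoulliWeight_mul_card, sum_bernoulliWeight_mul_card,
    sum_bernoulliWeight_mul_ite_eq_eventProb_not, sum_bernoulliWeight_mul_ite_eq_eventProb_not,
    ← Finset.sum_mul, sum_bernoulliWeight, one_mul, Fintype.card_fin] at hsum
  linarith

open Classical in
/-- **"Two bits of redundancy per erased qubit are necessary", finite form.** For every stabilizer code with `k`
logical qubits on `n` physical qubits and every erasure rate `0 ≤ ε ≤ ½`:
`k ≤ n · (1 − 2ε + 2·P_ε[erasure uncorrectable])`. [cite: BennettDivincenzoSmolin1997, p. 3218 (Q ≤ 1 − 2ε); DelfosseZemor2013, §3 eq. (capacity) (R ≤ 1 − 2p)] -/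
theorem stabilizer_k_le_card_mul_quantumErasure (hcode : IsAdditiveCode S k d) {ε : ℝ} (h0 : 0 ≤ ε)
    (h1 : ε ≤ 1 / 2) :
    (k : ℝ) ≤ n * (1 - 2 * ε + 2 * eventProb (fun M : Finset (Fin n) => ¬ IsCorrectableRegion S M) ε) := by
  have h := stabilizer_k_le_card_mul_erasure hcode h0 h0 (by linarith)
  have : (1 : ℝ) - ε - ε + eventProb (fun M : Finset (Fin n) => ¬ IsCorrectableRegion S M) ε +
      eventProb (fun M : Finset (Fin n) => ¬ IsCorrectableRegion S M) ε =
      1 - 2 * ε + 2 * eventProb (fun M : Finset (Fin n) => ¬ IsCorrectableRegion S M) ε := by ring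
  rwa [this] at h

end Finite

/-! ### Families: `ε_c ≤ 1/2` and `ε_c ≤ (1 − R)/2` -/

section Families

variable {nq : ℕ → ℕ} (S : ∀ i, Submodule (ZMod 2) (SympVec (nq i))) {k d : ℕ → ℕ}

open Classical in
/-- **No erasure rate `≥ ½` is below threshold** for a family of stabilizer codes with `k_i ≥ 1` (the failure
probability stays `≥ ½`). [cite: BennettDivincenzoSmolin1997, p. 3218 (Q = 0 for ε ≥ ½); DennisEtAl2002, §4.3 (below threshold)] -/
theorem stabilizer_erasure_not_belowThreshold_of_half_le (hcode : ∀ i, IsAdditiveCode (S i) (k i) (d i))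
    (hk : ∀ i, 1 ≤ k i) {y : ℝ} (hy : 1 / 2 ≤ y) (hy1 : y ≤ 1) :
    ¬ BelowThreshold
      (fun i y => eventProb (fun M : Finset (Fin (nq i)) => ¬ IsCorrectableRegion (S i) M) y) y := by
  intro h
  have hle := le_of_tendsto_of_tendsto' tendsto_const_nhds h
    (fun i => half_le_erasureFailure_of_half_le (hcode i) (hk i) hy hy1)
  norm_num at hle

open Classical in
/-- **Every certified erasure threshold of a stabilizer family with `k ≥ 1` is `≤ ½`.**
[cite: BennettDivincenzoSmolin1997, p. 3218 (Q = 0 for ε ≥ ½)] -/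
theorem stabilizer_erasure_threshold_le_half (hcode : ∀ i, IsAdditiveCode (S i) (k i) (d i)) (hk : ∀ i, 1 ≤ k i)
    {a : ℝ} (ha : IsThresholdLowerBound
      (fun i y => eventProb (fun M : Finset (Fin (nq i)) => ¬ IsCorrectableRegion (S i) M) y) a) :
    a ≤ 1 / 2 := by
  by_contra h
  push Not at h
  exact stabilizer_erasure_not_belowThreshold_of_half_le S hcode hk le_rfl (by norm_num)
    (ha (1 / 2) (by norm_num) h)

open Classical in
/-- **The erasure accuracy threshold of every stabilizer family with `k ≥ 1` is at most `½`** (BDS97: "the QEC's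
one-way capacity `Q` must vanish for `ε ≥ ½`"). [cite: BennettDivincenzoSmolin1997, p. 3218; DennisEtAl2002, §4.6 (p_c)] -/
theorem stabilizer_erasure_accuracyThreshold_le_half (hcode : ∀ i, IsAdditiveCode (S i) (k i) (d i))
    (hk : ∀ i, 1 ≤ k i) :
    accuracyThreshold
      (fun i y => eventProb (fun M : Finset (Fin (nq i)) => ¬ IsCorrectableRegion (S i) M) y) ≤ 1 / 2 :=
  stabilizer_erasure_threshold_le_half S hcode hk (isThresholdLowerBound_accuracyThreshold _)

/-- A family with `k ≥ 1` and `R n ≤ k` has `R ≤ 1`. [cite: CalderbankEtAl1998, §2 Thm. 1 (k ≤ n)] -/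
private theorem stabilizer_rate_le_one (hcode : ∀ i, IsAdditiveCode (S i) (k i) (d i)) (hk : ∀ i, 1 ≤ k i) {R : ℝ}
    (hR : ∀ i, R * (nq i : ℝ) ≤ k i) : R ≤ 1 := by
  have h1 : (k 0 : ℝ) ≤ nq 0 := by exact_mod_cast (hcode 0).k_le
  have hk0 : (1 : ℝ) ≤ k 0 := by exact_mod_cast hk 0
  have hn : (0 : ℝ) < nq 0 := by linarith
  have h2 : R * (nq 0 : ℝ) ≤ 1 * nq 0 := by linarith [hR 0]
  exact le_of_mul_le_mul_right h2 hn

open Classical in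
/-- **Two below-threshold erasure rates cost `a + b` of rate.** For a family of stabilizer codes with `k_i ≥ 1` and
rate `≥ R` (`R n_i ≤ k_i`): if the erasure rates `a` and `b` (`a, b ≥ 0`, `a + b ≤ 1`) are both below threshold, then
`a + b ≤ 1 − R`. [cite: BennettDivincenzoSmolin1997, p. 3218 (Q ≤ 1 − 2ε); DelfosseZemor2013, §3 eq. (capacity) and Thm. 3.5] -/
theorem stabilizer_erasure_rates_add_le_one_sub_rate (hcode : ∀ i, IsAdditiveCode (S i) (k i) (d i))
    (hk : ∀ i, 1 ≤ k i) {R : ℝ} (hR : ∀ i, R * (nq i : ℝ) ≤ k i) {a b : ℝ} (ha : 0 ≤ a) (hb : 0 ≤ b)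
    (hab : a + b ≤ 1)
    (hta : BelowThreshold
      (fun i y => eventProb (fun M : Finset (Fin (nq i)) => ¬ IsCorrectableRegion (S i) M) y) a)
    (htb : BelowThreshold
      (fun i y => eventProb (fun M : Finset (Fin (nq i)) => ¬ IsCorrectableRegion (S i) M) y) b) :
    a + b ≤ 1 - R := by
  have hbound : ∀ i, R ≤ 1 - a - b +
      (eventProb (fun M : Finset (Fin (nq i)) => ¬ IsCorrectableRegion (S i) M) a +
        eventProb (fun M : Finset (Fin (nq i)) => ¬ IsCorrectableRegion (S i) M) b) := by
    intro i
    have hk0 : (1 : ℝ) ≤ k i := by exact_mod_cast hk i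
    have hkn : (k i : ℝ) ≤ nq i := by exact_mod_cast (hcode i).k_le
    have hn : (0 : ℝ) < nq i := by linarith
    have h := (hR i).trans (stabilizer_k_le_card_mul_erasure (hcode i) ha hb hab)
    rw [mul_comm] at h
    have h' := le_of_mul_le_mul_left h hn
    linarith
  have hlim : Tendsto (fun i => 1 - a - b +
      (eventProb (fun M : Finset (Fin (nq i)) => ¬ IsCorrectableRegion (S i) M) a +
        eventProb (fun M : Finset (Fin (nq i)) => ¬ IsCorrectableRegion (S i) M) b)) atTop
      (𝓝 (1 - a - b + (0 + 0))) :=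
    tendsto_const_nhds.add (hta.add htb)
  have := le_of_tendsto_of_tendsto' tendsto_const_nhds hlim hbound
  linarith

open Classical in
/-- **`R ≤ 1 − 2ε` for stabilizer codes on the quantum erasure channel (BDS97 converse).** For every family of
stabilizer codes with `k_i ≥ 1` and rate `≥ R`: if the erasure rate `0 ≤ ε ≤ 1` is below threshold (failure
probability `→ 0`), then `2ε ≤ 1 − R`. [cite: BennettDivincenzoSmolin1997, p. 3218 (Q ≤ 1 − 2ε: two bits of redundancy per erased qubit are necessary); DelfosseZemor2013, §3 eq. (capacity)] -/
theorem stabilizer_quantumErasure_rate_le (hcode : ∀ i, IsAdditiveCode (S i) (k i) (d i)) (hk : ∀ i, 1 ≤ k i)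
    {R : ℝ} (hR : ∀ i, R * (nq i : ℝ) ≤ k i) {ε : ℝ} (h0 : 0 ≤ ε) (h1 : ε ≤ 1)
    (h : BelowThreshold
      (fun i y => eventProb (fun M : Finset (Fin (nq i)) => ¬ IsCorrectableRegion (S i) M) y) ε) :
    2 * ε ≤ 1 - R := by
  rcases le_or_gt ε (1 / 2) with hε | hε
  · have := stabilizer_erasure_rates_add_le_one_sub_rate S hcode hk hR h0 h0 (by linarith) h h
    linarith
  · exact absurd h (stabilizer_erasure_not_belowThreshold_of_half_le S hcode hk hε.le h1)

open Classical in
/-- **THE RATE–ERASURE-THRESHOLD TRADEOFF for stabilizer codes**: every certified erasure threshold lower bound `a` of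
a family of stabilizer codes with `k_i ≥ 1` and rate `≥ R` satisfies `a ≤ (1 − R)/2` (the BDS97 capacity converse
`ε_c ≤ (1 − R)/2`, i.e. `R ≤ 1 − 2ε_c`). [cite: BennettDivincenzoSmolin1997, p. 3218 (Q = max{0, 1 − 2ε}); DelfosseZemor2013, §3 eq. (capacity) and Thm. 3.5] -/
theorem stabilizer_quantumErasure_threshold_le_half_sub_rate (hcode : ∀ i, IsAdditiveCode (S i) (k i) (d i))
    (hk : ∀ i, 1 ≤ k i) {R : ℝ} (hR : ∀ i, R * (nq i : ℝ) ≤ k i) {a : ℝ}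
    (ha : IsThresholdLowerBound
      (fun i y => eventProb (fun M : Finset (Fin (nq i)) => ¬ IsCorrectableRegion (S i) M) y) a) :
    a ≤ (1 - R) / 2 := by
  by_contra h
  push Not at h
  have hR1 : R ≤ 1 := stabilizer_rate_le_one S hcode hk hR
  have ha2 : a ≤ 1 / 2 := stabilizer_erasure_threshold_le_half S hcode hk ha
  set p : ℝ := ((1 - R) / 2 + a) / 2 with hp
  have hp0 : 0 ≤ p := by rw [hp]; linarith
  have hpa : p < a := by rw [hp]; linarith
  have hp1 : p ≤ 1 := by rw [hp]; linarith
  have h2 := stabilizer_quantumErasure_rate_le S hcode hk hR hp0 hp1 (ha p hp0 hpa)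
  rw [hp] at h2
  linarith

open Classical in
/-- **Accuracy-threshold form**: `ε_c ≤ (1 − R)/2` for the erasure accuracy threshold of every family of stabilizer
codes with `k_i ≥ 1` and rate `≥ R`. [cite: BennettDivincenzoSmolin1997, p. 3218 (Q = max{0, 1 − 2ε}); DennisEtAl2002, §4.6 (p_c)] -/
theorem stabilizer_quantumErasure_accuracyThreshold_le_half_sub_rate (hcode : ∀ i, IsAdditiveCode (S i) (k i) (d i))
    (hk : ∀ i, 1 ≤ k i) {R : ℝ} (hR : ∀ i, R * (nq i : ℝ) ≤ k i) :
    accuracyThreshold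
        (fun i y => eventProb (fun M : Finset (Fin (nq i)) => ¬ IsCorrectableRegion (S i) M) y) ≤
      (1 - R) / 2 :=
  stabilizer_quantumErasure_threshold_le_half_sub_rate S hcode hk hR (isThresholdLowerBound_accuracyThreshold _)

end Families

/-! ### Achievability: stabilizer (indeed CSS) families at every rate below `1 − 2ε` -/

section Achievability

open Classical in
/-- **STABILIZER CODES ACHIEVE EVERY RATE BELOW `1 − 2ε` on the erasure channel** (transport of the CSS achievability
`exists_cssFamily_quantumErasure_tendsto_zero` through the dictionary `isCorrectableRegion_toSympCode_iff`): for
`0 < ε`, `0 ≤ R`, `2ε < 1 − R` there are stabilizer codes `S̄_n ≤ 𝔽₂ⁿ × 𝔽₂ⁿ` (`n = 0, 1, 2, …`) with `k_n ≥ R n` whose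
erasure-failure probability tends to `0` at every erasure rate `0 ≤ ε' ≤ ε`.
[cite: BennettDivincenzoSmolin1997, p. 3218 (lower bound by one-way random hash coding; footnote cf2: random linear stabilizer codes)] -/
theorem exists_stabilizerFamily_quantumErasure_tendsto_zero {ε R : ℝ} (hε : 0 < ε) (hR0 : 0 ≤ R)
    (h : 2 * ε < 1 - R) :
    ∃ (S : ∀ n : ℕ, Submodule (ZMod 2) (SympVec n)) (k d : ℕ → ℕ),
      (∀ n, IsAdditiveCode (S n) (k n) (d n)) ∧ (∀ n : ℕ, R * (n : ℝ) ≤ k n) ∧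
      ∀ ε', 0 ≤ ε' → ε' ≤ ε →
        Tendsto (fun n => eventProb (fun M : Finset (Fin n) => ¬ IsCorrectableRegion (S n) M) ε') atTop (𝓝 0) := by
  obtain ⟨HX, HZ, hc, hk, hlim⟩ := exists_cssFamily_quantumErasure_tendsto_zero hε hR0 h
  refine ⟨fun n => (CSSCode.ofMatrices (Matrix.of (HX n)) (Matrix.of (HZ n)) (hc n)).toSympCode,
    fun n => (CSSCode.ofMatrices (Matrix.of (HX n)) (Matrix.of (HZ n)) (hc n)).k,
    fun n => min (CSSCode.ofMatrices (Matrix.of (HX n)) (Matrix.of (HZ n)) (hc n)).dX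
      (CSSCode.ofMatrices (Matrix.of (HX n)) (Matrix.of (HZ n)) (hc n)).dZ,
    fun n => (CSSCode.ofMatrices (Matrix.of (HX n)) (Matrix.of (HZ n)) (hc n)).isAdditiveCode_toSympCode,
    hk, fun ε' h0 h1 => ?_⟩
  have hε1 : ε' ≤ 1 := by linarith
  refine squeeze_zero (fun n => eventProb_nonneg _ h0 hε1) (fun n => ?_) (hlim ε' h0 h1)
  refine eventProb_mono (fun M hM => ?_) h0 hε1
  rw [(CSSCode.ofMatrices (Matrix.of (HX n)) (Matrix.of (HZ n)) (hc n)).isCorrectableRegion_toSympCode_iff M,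
    not_and_or] at hM
  exact hM

end Achievability

/-! ### The distance FLOOR: `y^d ≤ P_y[erasure uncorrectable]` for every stabilizer code -/

section ErasureFloor

variable {n : ℕ} {S : Submodule (ZMod 2) (SympVec n)}

/-- **An erasure covering a problematic error is uncorrectable**: if `L ∈ S̄⊥ ∖ S̄` and `supp L ⊆ M`, then `M`
is not a correctable region (Cleaning Lemma case (1); "when the erasure vector covers a problematic error, we will
say that we have a non-correctable erasure"). [cite: DelfosseZemor2013, §3.1 (chunk p0007 L62–L66); BravyiTerhal2009, §2 Lemma 1 case (1)] -/
theorem not_isCorrectableRegion_of_sympSupport_subset {L : SympVec n} (hL : L ∈ sympDual S) (hLS : L ∉ S)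
    {M : Finset (Fin n)} (hM : sympSupport L ⊆ M) : ¬ IsCorrectableRegion S M :=
  fun h => hLS (h L hL (mem_supportedOn_of_forall_sympSupport fun _ hq => hM hq))

open Classical in
/-- **Erasure floor, every logical operator**: for `L ∈ S̄⊥ ∖ S̄` and every erasure rate `0 ≤ y ≤ 1`,
`y^{wt L} ≤ P_y[erasure uncorrectable]` (the erasures containing `supp L` alone have probability `y^{wt L}`).
[cite: DelfosseZemor2013, §3.1 (chunk p0007 L40–L47, L62–L66); Gottesman2014, §2 (locally decaying: Prob[T ⊆ E] = p^{|T|})] -/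
theorem pow_sympWeight_le_erasureFailure {L : SympVec n} (hL : L ∈ sympDual S) (hLS : L ∉ S) {y : ℝ}
    (hy0 : 0 ≤ y) (hy1 : y ≤ 1) :
    y ^ sympWeight L ≤ eventProb (fun M : Finset (Fin n) => ¬ IsCorrectableRegion S M) y := by
  rw [eventProb, ← card_sympSupport, ← sum_bernoulliWeight_filter_superset y (sympSupport L)]
  refine sum_le_sum_of_subset_of_nonneg (fun M hM => ?_) fun M _ _ => bernoulliWeight_nonneg hy0 hy1 M
  rw [mem_filter] at hM ⊢
  exact ⟨mem_univ _, not_isCorrectableRegion_of_sympSupport_subset hL hLS hM.2⟩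

open Classical in
/-- **THE ERASURE FLOOR `y^d ≤ P_y[erasure uncorrectable]`** for every subspace `S̄ ≤ 𝔽₂ⁿ × 𝔽₂ⁿ` with a logical
operator (`0 < d`, `d = minDistance S̄`) and every `0 ≤ y ≤ 1`. [cite: DelfosseZemor2013, §2.4 (minimum distance = minimum weight of a problematic error) and §3.1 (chunk p0007 L62–L66); DennisEtAl2002, §4.3] -/
theorem pow_minDistance_le_erasureFailure (hd : 0 < minDistance S) {y : ℝ} (hy0 : 0 ≤ y) (hy1 : y ≤ 1) :
    y ^ minDistance S ≤ eventProb (fun M : Finset (Fin n) => ¬ IsCorrectableRegion S M) y := by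
  obtain ⟨L, hL, hLS, hLd⟩ := exists_sympWeight_eq_minDistance ((minDistance_pos_iff S).1 hd)
  rw [← hLd]
  exact pow_sympWeight_le_erasureFailure hL hLS hy0 hy1

open Classical in
/-- Upper-bound form: if `S̄` has a logical operator of weight `≤ w` (`0 < minDistance S̄ ≤ w`), then
`y^w ≤ P_y[erasure uncorrectable]` for every `0 ≤ y ≤ 1`. [cite: DelfosseZemor2013, §3.1 (chunk p0007 L62–L66); DennisEtAl2002, §4.3] -/
theorem pow_le_erasureFailure_of_minDistance_le (hd : 0 < minDistance S) {w : ℕ} (hw : minDistance S ≤ w)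
    {y : ℝ} (hy0 : 0 ≤ y) (hy1 : y ≤ 1) :
    y ^ w ≤ eventProb (fun M : Finset (Fin n) => ¬ IsCorrectableRegion S M) y :=
  (pow_le_pow_of_le_one hy0 hy1 hw).trans (pow_minDistance_le_erasureFailure hd hy0 hy1)

open Classical in
/-- `[[n,k,d]]` form: an additive code with `k ≥ 1` has a logical operator, so `y^{minDistance S̄} ≤ P_y`
(`0 ≤ y ≤ 1`). [cite: DelfosseZemor2013, §3.1 (chunk p0007 L62–L66); CalderbankEtAl1998, §2 Thm. 1] -/
theorem pow_minDistance_le_erasureFailure_of_code {k d : ℕ} (hcode : IsAdditiveCode S k d) (hk : 1 ≤ k)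
    {y : ℝ} (hy0 : 0 ≤ y) (hy1 : y ≤ 1) :
    y ^ minDistance S ≤ eventProb (fun M : Finset (Fin n) => ¬ IsCorrectableRegion S M) y :=
  pow_minDistance_le_erasureFailure
    ((minDistance_pos_iff S).2 ((exists_logical_iff_logicalDim_pos hcode.1).2 (by rw [hcode.logicalDim_eq]; omega)))
    hy0 hy1

end ErasureFloor

/-! ### Families: bounded distance ⇒ no erasure threshold; an erasure threshold ⇒ `d → ∞` -/

section FloorFamilies

variable {nq : ℕ → ℕ} (S : ∀ i, Submodule (ZMod 2) (SympVec (nq i)))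

open Classical in
/-- **Bounded distance ⇒ no erasure threshold**: if every `S̄_i` has a logical operator and `minDistance S̄_i ≤ w`,
no erasure rate `0 < y ≤ 1` is below threshold (`P_y ≥ y^w` uniformly in `i`).
[cite: DennisEtAl2002, §4.3 (below threshold); DelfosseZemor2013, §3.1 (chunk p0007 L62–L66)] -/
theorem stabilizer_erasure_not_belowThreshold_of_minDistance_le (hd : ∀ i, 0 < minDistance (S i)) {w : ℕ}
    (hw : ∀ i, minDistance (S i) ≤ w) {y : ℝ} (hy0 : 0 < y) (hy1 : y ≤ 1) :
    ¬ BelowThreshold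
      (fun i y => eventProb (fun M : Finset (Fin (nq i)) => ¬ IsCorrectableRegion (S i) M) y) y :=
  not_belowThreshold_of_le (c := y ^ w) (by positivity) fun i =>
    pow_le_erasureFailure_of_minDistance_le (hd i) (hw i) hy0.le hy1

open Classical in
/-- **Erasure accuracy threshold `0`** for every family of subspaces with logical operators and bounded distance.
[cite: DennisEtAl2002, §4.6 (p_c); DelfosseZemor2013, §3.1 (chunk p0007 L62–L66)] -/
theorem stabilizer_erasure_accuracyThreshold_eq_zero_of_minDistance_le (hd : ∀ i, 0 < minDistance (S i))
    {w : ℕ} (hw : ∀ i, minDistance (S i) ≤ w) :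
    accuracyThreshold
      (fun i y => eventProb (fun M : Finset (Fin (nq i)) => ¬ IsCorrectableRegion (S i) M) y) = 0 :=
  accuracyThreshold_eq_zero_of_not_belowThreshold fun _ hy0 hy =>
    stabilizer_erasure_not_belowThreshold_of_minDistance_le S hd hw hy0 (by linarith)

open Classical in
/-- **AN ERASURE THRESHOLD FORCES `d → ∞`.** If every `S̄_i` has a logical operator and SOME erasure rate
`0 < y ≤ 1` is below threshold (`P_y[erasure uncorrectable] → 0`), then `minDistance S̄_i → ∞` (for every `w`,
eventually `minDistance S̄_i ≥ w`: otherwise `P_y ≥ y^w` along a subsequence).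
[cite: DennisEtAl2002, §4.3 (below threshold); DelfosseZemor2013, §3.1 (chunk p0007 L62–L66)] -/
theorem tendsto_minDistance_atTop_of_erasure_belowThreshold (hd : ∀ i, 0 < minDistance (S i)) {y : ℝ}
    (hy0 : 0 < y) (hy1 : y ≤ 1)
    (h : BelowThreshold
      (fun i y => eventProb (fun M : Finset (Fin (nq i)) => ¬ IsCorrectableRegion (S i) M) y) y) :
    Tendsto (fun i => minDistance (S i)) atTop atTop := by
  unfold BelowThreshold at h
  rw [tendsto_atTop]
  intro w
  have hc : (0 : ℝ) < y ^ w := by positivity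
  refine (h.eventually (gt_mem_nhds hc)).mono fun i hi => ?_
  by_contra hlt
  push Not at hlt
  have h1 := pow_le_erasureFailure_of_minDistance_le (hd i) hlt.le hy0.le hy1
  have hi' : eventProb (fun M : Finset (Fin (nq i)) => ¬ IsCorrectableRegion (S i) M) y < y ^ w := hi
  linarith

open Classical in
/-- `[[n_i,k_i,d_i]]` form: for a family of stabilizer codes with `k_i ≥ 1`, one below-threshold erasure rate
`0 < y ≤ 1` forces `minDistance S̄_i → ∞`. [cite: DennisEtAl2002, §4.3; DelfosseZemor2013, §3.1 (chunk p0007 L62–L66)] -/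
theorem tendsto_minDistance_atTop_of_erasure_belowThreshold_of_code {k d : ℕ → ℕ}
    (hcode : ∀ i, IsAdditiveCode (S i) (k i) (d i)) (hk : ∀ i, 1 ≤ k i) {y : ℝ} (hy0 : 0 < y) (hy1 : y ≤ 1)
    (h : BelowThreshold
      (fun i y => eventProb (fun M : Finset (Fin (nq i)) => ¬ IsCorrectableRegion (S i) M) y) y) :
    Tendsto (fun i => minDistance (S i)) atTop atTop :=
  tendsto_minDistance_atTop_of_erasure_belowThreshold S
    (fun i => (minDistance_pos_iff (S i)).2
      ((exists_logical_iff_logicalDim_pos (hcode i).1).2 (by rw [(hcode i).logicalDim_eq]; exact hk i)))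
    hy0 hy1 h

end FloorFamilies

end Literature.InformationTheory.QuantumCodes
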